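import Mathlib
import HarnessLib
import Summits.MatrixMultiplication.MatrixMultiplication.Theorems.OutsiderSandwichSlopeDial

/-!
# OutsiderSandwich — the corner-slope dial as EXCHANGE PROBLEMS between concrete tensors (decomp-mm lens 4, gen 31, part 3)

Route `route-MatrixMultiplication-OutsiderSandwich`; cut of record UNCHANGED.  Parts 1–2
(`OutsiderSandwichSlopeDialCore`, `OutsiderSandwichSlopeDial`) defined the dial `SlopeFloor t a μ` /
`SlopeCap t a μ` and calibrated it.  This file makes every RATIONAL dial setting a concrete exchange
inequality between products of two numbers `F⟨2,2,2⟩` and `F(t)` — by Strassen's spectral theorem the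
spectral form of an asymptotic restriction between two explicit tensors:

* `slopeFloor_rat_iff` — at a corner `(2, log₂ A)`, slope `p/q`:
  `SlopeFloor t (log₂A) (p/q) ⟺ ∀ F universal, A^q · F⟨2,2,2⟩^p ≤ 4^p · F(t)^q`
  («`A^q ⊙ ⟨2^p,2^p,2^p⟩ ≲ 4^p ⊙ t^{⊠q}`: `q` copies of `t`, discounted by `4^p/A^q`, buy `p` products of
  `2 × 2` matrices»);
* `cwFloor_rat_iff` — the `cw₂` corner: slope `p/q ⟺ ∀ F, 3^q F⟨2,2,2⟩^p ≤ 4^p F(cw₂)^q`; instances: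
  `cwFloor_third_exchange` — slope `1/3`, PROVED: `27 · F⟨2,2,2⟩ ≤ 4 · F(cw₂)^3` for every universal `F`
  (the laser floor = Coppersmith–Winograd's cube `cw₂^{⊠3}` read spectrally); slope `1/2` is
  `9 F⟨2,2,2⟩ ≤ 4 F(cw₂)^2`, slope `2/3` is `27 F⟨2,2,2⟩² ≤ 16 F(cw₂)^3`, slope `1` is `3 F⟨2,2,2⟩ ≤ 4 F(cw₂)`
  (`cwFloor_one_iff` of part 2) — the rungs of the dial are a ladder of such exchange problems, true up to
  slope `1/3`, open above, and `ω = 2` iff all of them hold (`summit_iff_forall_cwFloor`);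
* `blockFloor_rat_iff` — the block corner `(2,2)` of `C₁`: slope `p/q ⟺ ∀ F, 4^q F⟨2,2,2⟩^p ≤ 4^p F(C₁)^q`
  (slope `1` = the aside leaf `BlockOneIsMM`);
* `cwCap_of_asymptoticRank_le` — the RANK form of the residual family: `R̃(cw₂) ≤ 3 · 2^{μ'(ω−2)} ⟹
  SlopeCap cw₂ (log₂3) μ'` (a top point has `F(cw₂) ≤ R̃(cw₂)`); at `μ' = 1/3` the hypothesis is the
  registered stub `stub_rankCharge` of item 27897, so the stub implies the residual of record
  (`laserMergeOptimal_of_asymptoticRank_le`).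

References: Strassen, Crelle 384 (1988) Thm. 3.8 (spectral characterisation of `≲`) [Strassen1988];
Coppersmith–Winograd, JSC 9 (1990) §6 [CoppersmithWinograd1990]; Bürgisser–Clausen–Shokrollahi (1997)
Thm. 15.41 [BurgisserClausenShokrollahi1997]; Wigderson–Zuiddam, *Asymptotic spectra* (2023) §5
[WigdersonZuiddam2023].
-/

set_option linter.dupNamespace false

namespace Summit.MatrixMultiplication.MatrixMultiplication.Theorems.OutsiderSandwichSlopeDialExchange

open Literature.Computability.AlgebraicComplexity
open Summit.MatrixMultiplication.MatrixMultiplication.Theses.OutsiderSandwich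
open Summit.MatrixMultiplication.MatrixMultiplication.Theorems.OutsiderSandwichLaserFloor
  (one_le_map_matMulTensor)
open Summit.MatrixMultiplication.MatrixMultiplication.Theorems.OutsiderSandwichLaserFloorCut
  (three_le_map_cwTensor)
open Summit.MatrixMultiplication.MatrixMultiplication.Theorems.OutsiderSandwichLaserFloorTop
  (exists_top_point)
open Summit.MatrixMultiplication.MatrixMultiplication.Theorems.OutsiderSandwichCoupling (coupling₁)
open Summit.MatrixMultiplication.MatrixMultiplication.Theorems.OutsiderSandwichExchangeSpectral
  (four_le_map_coupling₁)
open Summit.MatrixMultiplication.MatrixMultiplication.Theorems.OutsiderSandwichSlopeDialCore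
open Summit.MatrixMultiplication.MatrixMultiplication.Theorems.OutsiderSandwichSlopeDial

/-! ## §1  Rational slopes are exchange inequalities -/

/-- Pointwise form: for positive reals `A, M, T` and naturals `p, q` with `q > 0`,
`log₂A + (p/q)(log₂M − 2) ≤ log₂T ⟺ A^q · M^p ≤ 4^p · T^q`. [folklore] -/
theorem corner_line_le_iff {A M T : ℝ} (hA : 0 < A) (hM : 0 < M) (hT : 0 < T) {p q : ℕ}
    (hq : 0 < q) :
    Real.logb 2 A + (p : ℝ) / q * (Real.logb 2 M - 2) ≤ Real.logb 2 T ↔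
      A ^ q * M ^ p ≤ (4 : ℝ) ^ p * T ^ q := by
  have hq' : (0 : ℝ) < q := by exact_mod_cast hq
  have hl : Real.logb 2 (A ^ q * M ^ p) = q * Real.logb 2 A + p * Real.logb 2 M := by
    rw [Real.logb_mul (pow_pos hA q).ne' (pow_pos hM p).ne', Real.logb_pow, Real.logb_pow]
  have hr : Real.logb 2 ((4 : ℝ) ^ p * T ^ q) = 2 * p + q * Real.logb 2 T := by
    rw [Real.logb_mul (pow_pos (by norm_num : (0 : ℝ) < 4) p).ne' (pow_pos hT q).ne', Real.logb_pow,
      Real.logb_pow, show (4 : ℝ) = 2 ^ (2 : ℕ) by norm_num, Real.logb_pow,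
      Real.logb_self_eq_one one_lt_two]
    ring
  rw [show (A ^ q * M ^ p ≤ (4 : ℝ) ^ p * T ^ q ↔
      Real.logb 2 (A ^ q * M ^ p) ≤ Real.logb 2 ((4 : ℝ) ^ p * T ^ q)) from
    (Real.logb_le_logb one_lt_two (mul_pos (pow_pos hA q) (pow_pos hM p))
      (mul_pos (pow_pos (by norm_num : (0 : ℝ) < 4) p) (pow_pos hT q))).symm, hl, hr]
  constructor
  · intro h
    have := mul_le_mul_of_nonneg_left h hq'.le
    have e : (q : ℝ) * (Real.logb 2 A + (p : ℝ) / q * (Real.logb 2 M - 2)) =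
        q * Real.logb 2 A + p * Real.logb 2 M - 2 * p := by
      field_simp
      ring
    linarith [this, e]
  · intro h
    have e : (q : ℝ) * (Real.logb 2 A + (p : ℝ) / q * (Real.logb 2 M - 2)) =
        q * Real.logb 2 A + p * Real.logb 2 M - 2 * p := by
      field_simp
      ring
    have h2 : (q : ℝ) * (Real.logb 2 A + (p : ℝ) / q * (Real.logb 2 M - 2)) ≤ q * Real.logb 2 T := by
      rw [e]; linarith
    exact le_of_mul_le_mul_left h2 hq'

/-- **Rational slopes are exchange problems.**  At a corner `(2, log₂A)` (`A > 0`) of a tensor `t` taking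
positive values at universal points, `SlopeFloor t (log₂A) (p/q) ⟺ ∀ F, A^q·F⟨2,2,2⟩^p ≤ 4^p·F(t)^q` —
the spectral form of `A^q ⊙ ⟨2^p,2^p,2^p⟩ ≲ 4^p ⊙ t^{⊠q}`. [cite: Strassen1988, Thm. 3.8] -/
theorem slopeFloor_rat_iff {ι κ μ : Type} [Fintype ι] [Fintype κ] [Fintype μ] {t : ι → κ → μ → ℂ}
    {A : ℝ} (hA : 0 < A)
    (ht : ∀ F : SpectralMap ℂ, IsUniversalSpectralPoint ℂ F → 0 < F t) {p q : ℕ} (hq : 0 < q) :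
    SlopeFloor t (Real.logb 2 A) ((p : ℝ) / q) ↔
      ∀ F : SpectralMap ℂ, IsUniversalSpectralPoint ℂ F →
        A ^ q * F (matMulTensor ℂ 2 2 2) ^ p ≤ (4 : ℝ) ^ p * F t ^ q := by
  have key : ∀ F : SpectralMap ℂ, IsUniversalSpectralPoint ℂ F →
      (Real.logb 2 A + (p : ℝ) / q * (Real.logb 2 (F (matMulTensor ℂ 2 2 2)) - 2) ≤ Real.logb 2 (F t) ↔
        A ^ q * F (matMulTensor ℂ 2 2 2) ^ p ≤ (4 : ℝ) ^ p * F t ^ q) := fun F hF =>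
    corner_line_le_iff hA (lt_of_lt_of_le one_pos (one_le_map_matMulTensor hF (by norm_num))) (ht F hF) hq
  exact ⟨fun h F hF => (key F hF).1 (h F hF), fun h F hF => (key F hF).2 (h F hF)⟩

/-! ## §2  The `cw₂` corner: the ladder of exchange problems -/

/-- **`cw₂` corner, slope `p/q`:** `SlopeFloor cw₂ (log₂3) (p/q) ⟺ ∀ F, 3^q·F⟨2,2,2⟩^p ≤ 4^p·F(cw₂)^q`
(«`3^q ⊙ ⟨2^p,2^p,2^p⟩ ≲ 4^p ⊙ cw₂^{⊠q}`»). [cite: Strassen1988, Thm. 3.8; CoppersmithWinograd1990, §6] -/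
theorem cwFloor_rat_iff {p q : ℕ} (hq : 0 < q) :
    SlopeFloor (cwTensor ℂ 2) (Real.logb 2 3) ((p : ℝ) / q) ↔
      ∀ F : SpectralMap ℂ, IsUniversalSpectralPoint ℂ F →
        (3 : ℝ) ^ q * F (matMulTensor ℂ 2 2 2) ^ p ≤ (4 : ℝ) ^ p * F (cwTensor ℂ 2) ^ q :=
  slopeFloor_rat_iff (by norm_num)
    (fun _ hF => lt_of_lt_of_le (by norm_num) (three_le_map_cwTensor hF)) hq

/-- **Slope `1/3`, PROVED (the laser floor as an exchange):** `27 · F⟨2,2,2⟩ ≤ 4 · F(cw₂)^3` for every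
universal point — spectrally, `⟨27⟩ ⊠ ⟨2,2,2⟩ ≲ ⟨4⟩ ⊠ cw₂^{⊠3}`. [cite: CoppersmithWinograd1990, §6] -/
theorem cwFloor_third_exchange (F : SpectralMap ℂ) (hF : IsUniversalSpectralPoint ℂ F) :
    27 * F (matMulTensor ℂ 2 2 2) ≤ 4 * F (cwTensor ℂ 2) ^ 3 := by
  have h := (cwFloor_rat_iff (p := 1) (q := 3) (by norm_num)).1
    (by rw [show ((1 : ℕ) : ℝ) / (3 : ℕ) = 1 / 3 by norm_num]; exact cwFloor_third) F hF
  norm_num at h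
  linarith

/-- Slope `1/2` of the `cw₂` dial is the exchange `9 · F⟨2,2,2⟩ ≤ 4 · F(cw₂)^2`
(«`⟨9⟩ ⊠ ⟨2,2,2⟩ ≲ ⟨4⟩ ⊠ cw₂^{⊠2}`», open; it would give `LaserTangency` and `ω ≤ 6 − 2 log₂3 ≈ 2.83`).
[cite: Strassen1988, Thm. 3.8] -/
theorem cwFloor_half_iff :
    SlopeFloor (cwTensor ℂ 2) (Real.logb 2 3) (1 / 2) ↔
      ∀ F : SpectralMap ℂ, IsUniversalSpectralPoint ℂ F →
        9 * F (matMulTensor ℂ 2 2 2) ≤ 4 * F (cwTensor ℂ 2) ^ 2 := by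
  have h := cwFloor_rat_iff (p := 1) (q := 2) (by norm_num)
  rw [show ((1 : ℕ) : ℝ) / (2 : ℕ) = 1 / 2 by norm_num] at h
  rw [h]
  refine forall₂_congr fun F _ => ?_
  norm_num

/-- Slope `2/3` of the `cw₂` dial is the exchange `27 · F⟨2,2,2⟩^2 ≤ 16 · F(cw₂)^3`
(«`⟨27⟩ ⊠ ⟨4,4,4⟩ ≲ ⟨16⟩ ⊠ cw₂^{⊠3}`», open). [cite: Strassen1988, Thm. 3.8] -/
theorem cwFloor_twoThirds_iff :
    SlopeFloor (cwTensor ℂ 2) (Real.logb 2 3) (2 / 3) ↔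
      ∀ F : SpectralMap ℂ, IsUniversalSpectralPoint ℂ F →
        27 * F (matMulTensor ℂ 2 2 2) ^ 2 ≤ 16 * F (cwTensor ℂ 2) ^ 3 := by
  have h := cwFloor_rat_iff (p := 2) (q := 3) (by norm_num)
  rw [show ((2 : ℕ) : ℝ) / (3 : ℕ) = 2 / 3 by norm_num] at h
  rw [h]
  refine forall₂_congr fun F _ => ?_
  norm_num

/-! ## §3  The block corner: the leaf's ladder -/

/-- **Block corner, slope `p/q`:** `SlopeFloor C₁ 2 (p/q) ⟺ ∀ F, 4^q·F⟨2,2,2⟩^p ≤ 4^p·F(C₁)^q`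
(«`⟨4^q⟩ ⊠ ⟨2^p,2^p,2^p⟩ ≲ ⟨4^p⟩ ⊠ C₁^{⊠q}`»; slope `1` = the aside leaf). [cite: Strassen1988, Thm. 3.8] -/
theorem blockFloor_rat_iff {p q : ℕ} (hq : 0 < q) :
    SlopeFloor coupling₁ 2 ((p : ℝ) / q) ↔
      ∀ F : SpectralMap ℂ, IsUniversalSpectralPoint ℂ F →
        (4 : ℝ) ^ q * F (matMulTensor ℂ 2 2 2) ^ p ≤ (4 : ℝ) ^ p * F coupling₁ ^ q := by
  have e : (2 : ℝ) = Real.logb 2 4 := by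
    rw [show (4 : ℝ) = 2 ^ (2 : ℕ) by norm_num, Real.logb_pow, Real.logb_self_eq_one one_lt_two]
    norm_num
  rw [e]
  exact slopeFloor_rat_iff (by norm_num)
    (fun _ hF => lt_of_lt_of_le (by norm_num) (four_le_map_coupling₁ hF)) hq

/-- Slope `1/2` of the block dial: `16 · F⟨2,2,2⟩ ≤ 4 · F(C₁)^2`, i.e. `4 F⟨2,2,2⟩ ≤ F(C₁)^2`
(«`⟨4⟩ ⊠ ⟨2,2,2⟩ ≲ C₁^{⊠2}`», open, weaker than the leaf; cash value `2^ω ≤ 49/4`). [cite: Strassen1988, Thm. 3.8] -/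
theorem blockFloor_half_iff :
    SlopeFloor coupling₁ 2 (1 / 2) ↔
      ∀ F : SpectralMap ℂ, IsUniversalSpectralPoint ℂ F →
        4 * F (matMulTensor ℂ 2 2 2) ≤ F coupling₁ ^ 2 := by
  have h := blockFloor_rat_iff (p := 1) (q := 2) (by norm_num)
  rw [show ((1 : ℕ) : ℝ) / (2 : ℕ) = 1 / 2 by norm_num] at h
  rw [h]
  refine forall₂_congr fun F _ => ?_
  constructor <;> intro h' <;> nlinarith [h']

/-! ## §4  The rank form of the residual family -/

/-- **Rank cap ⟹ dial cap:** `R̃(cw₂) ≤ 3 · 2^{μ'(ω − 2)} ⟹ SlopeCap cw₂ (log₂3) μ'` (a top point has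
`F(cw₂) ≤ R̃(cw₂)` by rank duality). [cite: Strassen1988, Thm. 3.8; CoppersmithWinograd1990, §6] -/
theorem cwCap_of_asymptoticRank_le {s : ℝ}
    (h : asymptoticRank (cwTensor ℂ 2) ≤ 3 * (2 : ℝ) ^ (s * (omega ℂ - 2))) :
    SlopeCap (cwTensor ℂ 2) (Real.logb 2 3) s := by
  obtain ⟨G, hG, hGω⟩ := exists_top_point
  refine ⟨G, hG, hGω, ?_⟩
  have hG0 : 0 < G (cwTensor ℂ 2) := lt_of_lt_of_le (by norm_num) (three_le_map_cwTensor hG)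
  have h1 : G (cwTensor ℂ 2) ≤ 3 * (2 : ℝ) ^ (s * (omega ℂ - 2)) :=
    ((strassen_duality_asymptoticRank_holds ℂ (cwTensor ℂ 2)).1 G hG).trans h
  have h2 := Real.logb_le_logb_of_le one_lt_two hG0 h1
  rwa [Real.logb_mul (by norm_num) (Real.rpow_pos_of_pos two_pos _).ne',
    Real.logb_rpow two_pos (by norm_num)] at h2

/-- In particular the registered stub `stub_rankCharge : R̃(cw₂) ≤ 3 · 2^{(ω−2)/3}` of item 27897 implies
the residual of record `LaserMergeOptimal`. [cite: CoppersmithWinograd1990, §6] -/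
theorem laserMergeOptimal_of_asymptoticRank_le
    (h : asymptoticRank (cwTensor ℂ 2) ≤ 3 * (2 : ℝ) ^ ((omega ℂ - 2) / 3)) : LaserMergeOptimal := by
  refine cwCap_third_iff.1 (cwCap_of_asymptoticRank_le ?_)
  rwa [show (1 : ℝ) / 3 * (omega ℂ - 2) = (omega ℂ - 2) / 3 by ring]

end Summit.MatrixMultiplication.MatrixMultiplication.Theorems.OutsiderSandwichSlopeDialExchange
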